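import Mathlib
import HarnessLib
import HarnessLib.Audit
import Summits.Parity.Statement
import Literature.NumberTheory.Sieve.LinearEquationsInPrimes
import Literature.NumberTheory.Sieve.MoebiusShiftedPrimes

/-!
Route: KataiPropagation

CLOSED (retired) 2026-08-15T13:49:50Z by operator:999:1257524 — reason: not-a-thesis: assembly does not conclude the sub-problem Statement — note: D-0027 §2.1 audit (human 2026-08-15: routes that do not decide the summit are removed): the assembly concludes `MobiusDilatedShiftedPrimes`, not the sub-problem statement; a NEW conforming route may be opened from the same idea (generated `closes : … → _root_.GeneralizedHardyLittlewood`).. The file is kept as the record of this route; refuted decls are indexed as negative knowledge (`ledger negatives`).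

# Route KataiPropagation — Kátai propagation — a Möbius bias along shifted primes forces an EXCESS
of prime pairs in the polylog two-coefficient twin family (pmn+h, qmn+h)

It suffices — for the parity atom shared with routes MobiusShiftedPrimes /
ShiftedMultiplicationTable (stmt-Parity-0612:
∑_{d≤x} μ(d)Λ(dm+h) = o(x) for all m, h ≥ 1; m = 1 is the folklore conjecture "μ ⟂ shifted primes",
Literature.NumberTheory.Sieve.MoebiusShiftedPrimesConjecture up to the sign of the shift) — to show
X = BlockPairExcess (card
katai-propagation-shifted-primes, sharpened): for every m, h ≥ 1, c > 0, ε > 0, all large x and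
every P with log x ≤ P ≤ (log x)^c,
the two-coefficient twin systems (p·m·n + h, q·m·n + h), p ≠ q primes in the dyadic block (P, 2P],
have ON AVERAGE OVER THE BLOCK at
most the Hardy–Littlewood number of prime pairs: ∑_{p≠q∈(P,2P]} [ ∑_{n ≤ x/max(p,q)}
Λ(pmn+h)Λ(qmn+h) − 𝔖_{pq}·x/max(p,q) ] ≤ ε·x·P/(log P)²
(𝔖_{pq} = Green–Tao singular product of the system; one-sided, signed, block-averaged,
o(1)-precision, polylog coefficients).
The other half of the route is an UNCONDITIONAL theorem, KataiRigidity (rank 3, provable now from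
proved tree facts): a bias
|∑_{d≤x} μ(d)Λ(dm+h)| ≥ ηx forces, at the same x, a block P ∈ [log x, (log x)^{c(η,m)}] violating
that inequality with ε = ε(η,m) > 0.
Assembly = KataiRigidity → BlockPairExcess → stmt-0612 (pure logic, checked sorry-free in
Sketch.lean).
Lean: `∀ m h : ℕ, 1 ≤ m → 1 ≤ h → ∀ c : ℝ, 0 < c → ∀ ε : ℝ, 0 < ε → ∃ x₀ : ℕ, ∀ x : ℕ, x₀ ≤ x → ∀ P
: ℕ, Real.log x ≤ P → (P : ℝ) ≤ Real.log x ^ c → (∑ p ∈ Finset.filter Nat.Prime (Finset.Ioc P (2 *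
P)), ∑ q ∈ Finset.filter Nat.Prime (Finset.Ioc P (2 * P)) with q ≠ p, ((∑ n ∈ Finset.Icc 1 (x / max
p q), ArithmeticFunction.vonMangoldt (p * m * n + h) * ArithmeticFunction.vonMangoldt (q * m * n +
h)) - Literature.NumberTheory.Sieve.singularProduct ![(⟨![((p * m : ℕ) : ℤ)], (h : ℤ)⟩ :
Literature.NumberTheory.Sieve.AffLinForm 1), ⟨![((q * m : ℕ) : ℤ)], (h : ℤ)⟩] * ((x : ℝ) / max p
q))) ≤ ε * x * P / Real.log P ^ 2`

## Assembly
Pure logic (proved sorry-free as `assembly_holds` in the planner's Sketch.lean, axioms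
propext/choice/Quot.sound): fix m, h and η > 0;
KataiRigidity yields c, ε, x₀; BlockPairExcess with (c, ε/2) yields x₁; for x ≥ max(x₀, x₁, 3) a
bias ≥ ηx would give a block P ≥ log x > 1,
so P ≥ 2, log P > 0, and ε xP/log²P ≤ (ε/2) xP/log²P, absurd; hence |∑_{d≤x} μ(d)Λ(dm+h)| < ηx
eventually, for every η, which is the
little-o statement 0612. Continuation beyond this route (NOT items, and NOT reachable by this
mechanism): 0612 is the pointwise atom;
route MobiusShiftedPrimes' Assembly consumes the m-UNIFORM log-power form M_avg (stmt-0613) together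
with EH, which Kátai propagation
cannot supply (its exponents c(η) ≍ exp(9w²/η²) make o(x) the ceiling); tuples and
DicksonFibration.Assembly then carry Hardy–Littlewood to
the conjunct. So the route's contribution to GHL is structural: the binary slice of GHL is
internally RIGID — its polylog two-coefficient
sub-family (an instance of Conjecture 1.2 with growing size) already decides μ ⟂ shifted primes, and
only through pair EXCESS.

Rationale: WHY THIS LINE. Kátai's identity μ(pn) = −μ(n) (p ∤ n) makes a Möbius bias along the sparse support
S_{m,h} = {d : dm+h prime} an average, over primes
p in a window I, of μ against the DILATED supports {n : pmn+h prime}; Turán–Kubilius on S_{m,h} and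
a Cauchy–Schwarz in n then bound the
bias by the second moment ∑_n (∑_{p∈I} (Λ−ν)(p m n + h))², whose off-diagonal is exactly the signed
Hardy–Littlewood defect of the
two-coefficient systems (pmn+h, qmn+h) once a fundamental-lemma model ν is subtracted
(BourgainSarnakZiegler2013 Thm 2 / Kátai 1986 /
Tao2012ChowlaSarnakBlog for the dense criterion; TaoFMP2016 §2 for its modern form). Two things are
new relative to the card and make the
line honest: (i) a DYADIC decomposition of I turns the needed precision into a constant ε(η) ≍ η²
per block (the card needed (log x)^{-A}),
so the input is of the same o(1) species as GHL itself — Green–Tao Conjecture 1.2 for the family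
with ‖Ψ‖_N ≤ (log N)^c instead of ≤ L
(GreenTao2010); (ii) the inequality is ONE-SIDED: ∑_n G² = diagonal + off-diagonal exactly, so only
an EXCESS of prime pairs can carry a
Möbius bias — the crux is an upper bound, the mirror image of the fixed-modulus variance problem of
Hooley / Friedlander–Goldston, where
the LOWER bound is the unconditional side and the asymptotic needs RH + uniform prime pairs
(doi:10.1093/qmath/47.3.313 Thms 2–3;
arXiv:1301.5663 p.3). All analytic inputs of the rigidity theorem are PROVED in the tree
(siegel_walfisz_holds, SiegelWalfiszMoebius_holds,
SieveSequence.fundamental_lemma_uniform_holds): polylog moduli only, no Bombieri–Vinogradov, no EH.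
Imported area: probabilistic number
theory (Turán–Kubilius / Erdős–Kac on shifted primes, Halberstam–Elliott–Hildebrand,
doi:10.1112/plms/s3-59.2.209) joined to
Hardy–Littlewood bookkeeping; what no existing route does: an unconditional edge ACROSS members of
GHL's binary slice (the seven routes
of the sub either assume EH/GEH or attack one pair), landing directly on the shared atom 0612.

RANKED CRUXES. #2 BlockPairExcess (crux) — for all m, h ≥ 1, c > 0, ε > 0 there is x₀ such that for
x ≥ x₀ and every natural P with log x ≤ P ≤ (log x)^c: ∑ over ordered pairs of distinct primes p, q
∈ (P, 2P] of [∑_{1≤n≤x/max(p,q)} Λ(pmn+h)Λ(qmn+h) − 𝔖(pm,qm,h)·x/max(p,q)] ≤ ε x P/(log P)², 𝔖 =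
Literature.NumberTheory.Sieve.singularProduct of the Green–Tao system (pm·n+h, qm·n+h) (card item
r3, weakened to one-sided / block-averaged / o(1) precision). [difficulty: open-problem] (why it
might fail: A (1+ε)-sharp UPPER bound for prime pairs is parity-blocked per system (Bombieri's ghost
1+λ doubles every N_pq coherently; sieves stop at 2–4×HL) and the block averages only ≍P²/log²P =
polylog² systems — no ternary structure; a Hooley-type variance bound open even on GRH.)
[doi:10.1093/qmath/47.3.313, arXiv:1301.5663, GreenTao2010, GoldstonMontgomery1987, Harman2007,
Literature.Barriers.Parity.PrimePairParity]
#3 KataiRigidity (crux) — KÁTAI RIGIDITY (unconditional, one-sided; card item r2 sharpened): for all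
m, h ≥ 1 and η > 0 there are c, ε > 0 and x₀ such that for every x ≥ x₀ with |∑_{d≤x} μ(d)Λ(dm+h)| ≥
ηx there is a natural P, log x ≤ P ≤ (log x)^c, whose block (P,2P] has prime-pair EXCESS ∑_{p≠q}
[N_pq(x) − 𝔖_pq·x/max(p,q)] ≥ ε x P/(log P)². Proof plan (NOTES.md): TK on the Λ(dm+h)-weighted
support with I = primes in (P₁,P₀], L = ∑1/p ≥ 9w²/η² (w = m/φ(m)); Kátai switch; model ν =
wV⁻¹·1[(dm+h, P_m(z))=1], z = (log x)^{1/3}, killed against μ by the β-sieve majorant +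
Siegel–Walfisz for μ; dyadic Cauchy–Schwarz with P₁ ≍ C(η,m) log x, P₀ = (log x)^{exp(9w²/η²+O(1))};
model cross terms = 𝔖_pq·y(1+O(e^{-s}+1/z+1/P₁)) by the fundamental lemma (κ = 1, 2) and
Siegel–Walfisz for primes (moduli ≤ polylog); all inputs proved in tree. [difficulty: XL] (why it
might fail: Budget checked by hand only: TK wants L≥9w²/η², the diagonal wants P₁≳w(L+1)log
x/(L²η²), block precision ε≍(Lη/(L+1))² suffices since ∑_j w_j/j≈L cancels; a hidden log-loss in the
model cross terms (FL at z=(log x)^{1/3}) or in ∑_j 1/j would force (log x)^{-A} precision instead.)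
[BourgainSarnakZiegler2013, Tao2012ChowlaSarnakBlog, TaoFMP2016, doi:10.1112/plms/s3-59.2.209,
MontgomeryVaughan2007, Literature.NumberTheory.LFunctions.siegel_walfisz_holds,
Literature.NumberTheory.LFunctions.SiegelWalfiszMoebius_holds,
Literature.NumberTheory.Sieve.SieveSequence.fundamental_lemma_uniform_holds]
#9 MobiusDilatedShiftedPrimes (support) — terminal node, identical by signature to stmt-Parity-0612
(route MobiusShiftedPrimes crux r2, also the terminal node of route ShiftedMultiplicationTable): for
all m, h ≥ 1, ∑_{d≤x} μ(d)Λ(dm+h) = o(x). Not attacked directly; delivered by the Assembly; filed so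
that a refutation of 0612 breaks this route too. [difficulty: open-problem]
[Literature.NumberTheory.Sieve.MoebiusShiftedPrimesConjecture, Lichtman2020, MurtyVatwani2017]
#9 PolylogTwinFamilyHL (support) — the GHL-shaped sufficient condition (stronger than
BlockPairExcess, two-sided and uniform; not on the assembly chain; filed so that GHL-family routes
share it): Green–Tao Conjecture 1.2 verbatim — same vonMangoldtSum / archFactor / singularProduct, d
= 1, t = 2, error ≤ εN, all convex K ⊆ [−N,N] — for the systems (a·n + h, b·n + h), a ≠ b ≥ 1, h ≠
0, with POLYLOG uniformity a, b, |h| ≤ (log N)^c replacing ‖Ψ‖_N ≤ L. Safe side of the Maier /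
Friedlander–Granville uniformity barrier (length N ≥ height^{1/o(1)}, Granville's regime x >
h(F)^ε). [difficulty: open-problem] [GreenTao2010, Granville1995Irregularities,
Literature.Barriers.Parity.UniformBatemanHornBarrier,
Literature.Barriers.Parity.FriedlanderGranvilleUniformityBarrier]
#9 UniformToBlock (support) — glue: PolylogTwinFamilyHL → BlockPairExcess. Apply the uniform
statement with c+2, ε/8 to each system (pm·n+h, qm·n+h) on K = [1, N], N = ⌊x/max(p,q)⌋ (archFactor
= N − 1, vonMangoldtSum = the pair sum exactly), sum over the ≤ 4P²/log²P ordered pairs of the block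
and absorb ∑𝔖_pq ≪_m P² log log P/log²P = o(xP/log²P); needs convergence and the bound 𝔖_pq ≪
w²·|p−q|/φ(|p−q|) for the explicit singular product (Green–Tao Lemma 1.3 for this family,
elementary). [difficulty: M] [GreenTao2010]
#9 FolkloreBridge (support) — the same mechanism for NEGATIVE constants: Kátai on the support {n : n
− h prime} gives systems (pk − h, qk − h); with PolylogTwinFamilyHL (h ∈ ℤ, both signs) and partial
summation from Λ-weights to the prime count one gets the registered folklore conjecture ∑_{p≤X}
μ(p+h) = o(π(X)) for every h ≥ 1 (Lichtman 2020 p.1; Sarnak Problem 5.2 at h = 1). Provable now by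
re-running the KataiRigidity proof with −h. [difficulty: XL] [Lichtman2020,
BourgainSarnakZiegler2013, Literature.NumberTheory.Sieve.MoebiusShiftedPrimesConjecture]

TWO-LAYER PLAN. Foreseen glued splits (k ≤ 3, depth 1), filed only when a crux closes or stalls with
a census:
KataiRigidity ⇐ KataiReduction (TK + Kátai switch + model subtraction: bias ⟹ ∑_j |T₁^{(j)}| ≥
Lηx/4, with the model ν fixed in the
statement) → BlockSecondMoment (∑_n G_j(n)² = D_j + Def_j + O(ε₁M_j): the fundamental-lemma /
Siegel–Walfisz evaluation of the diagonal
and of the model cross terms against the Green–Tao singular product) → KataiRigidity (dyadic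
Cauchy–Schwarz bookkeeping).
BlockPairExcess ⇐ VarianceForm (restate as an upper bound (1+ε)·expected for the second moment over
n ≤ x/P of the number of primes
pmn+h, p ∈ (P,2P] prime — a Hooley-type fixed-residue short-window variance) → MinorArcCross (∫ over
minor arcs of ∑_{p≠q} S_p S̄_q ≤ ε·main,
S_p(α) = ∑_n Λ(pmn+h)e(αn)) → BlockPairExcess; or by regime: P ≤ (log x)^{1+δ} (Poisson regime, few
pairs per n) vs P large.

KILL CRITERIA. BlockPairExcess REFUTED for some (m,h,c) (a block family with persistent pair excess
≥ εxP/log²P) closes the route (`refuted:BlockPairExcess`)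
and is itself news: by KataiRigidity's converse direction nothing follows for μ, but uniform GHL for
the family (PolylogTwinFamilyHL) dies
with it. KataiRigidity REFUTED as stated (budget error) ⇒ pivot, not close: restate with (log
x)^{-A} precision / a wider block range
[log x, (log x)^{c}] → [(log x)^{1-δ}, exp((log x)^δ)] (the card's original r3), same assembly
shape. stmt-0612 refuted for some (m,h)
⇒ the gate breaks this route together with MobiusShiftedPrimes and ShiftedMultiplicationTable; then
¬BlockPairExcess for that (m,h) becomes
a THEOREM via KataiRigidity (file it). 0612 proved elsewhere (e.g. by ShiftedMultiplicationTable)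
moots the assembly but not KataiRigidity,
which keeps stand-alone value as a refuter's consistency filter.

NOT DECOMPOSED YET. The quantitative form of KataiRigidity (explicit c(η,m) = exp(9w²/η²+O(1)),
ε(η,m) ≍ η²; and the Ramaré-identity variant
1 = ∑_{p|n, p∈I} 1/ω_I(n) replacing Turán–Kubilius, which should give c(η,m) ≍ C·w/η at the price of
a Siegel–Walfisz bound for
μ(n)t^{ω_I(n)}, a convolution of the proved SiegelWalfiszMoebius with an I-smooth kernel) — later
support items; the λ-version
(λ(pn) = −λ(n) with no coprimality bookkeeping); uniformity in h ≤ (log x)^c and in m ≤ (log x)^c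
(free in the proof, not needed by 0612);
the necessity heuristic "primes up to (log x)^{1−o(1)} are needed by ANY argument using only
multiplicativity on I + equidistribution of μ
in APs + HL-randomness of primes" (ghost g = (−1)^{Ω_I}·h(I-free part); the I-part of a typical d
must beat the sparsity 1/log x) — a
method-level remark, not an item; any engine for BlockPairExcess (circle method in the variance
form, dispersion) — tenure work.

CHEAPEST FALSIFIER. (1) A refuter re-derives the CS budget of KataiRigidity (NOTES.md "Proof
sketch", conditions C1–C5): if the block-relative precision
needed is NOT a constant ε(η,m) but decays with x, the rank-3 statement is false as typed and must
be restated (pivot above) — a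
one-page computation. (2) Numerics are useless here (c(η) is astronomically large), but a grounder's
literature check is cheap: is the
relative (sparse-support, model-subtracted) Kátai inequality already in Hildebrand 1989
(doi:10.1112/plms/s3-59.2.209, paywalled, want
acq-02496), Timofeev 1991–95, Elliott's 'shifted primes' papers, or Matomäki–Radziwiłł–Tao's
sign-pattern papers? If yes, KataiRigidity is
'known' up to the HL-defect reading and the route's novelty shrinks to the one-sided block
formulation. (3) `lean check` of Sketch.lean
(done: rc 0, assembly proved).

NUMBERS. Parameters of the rigidity proof (crude, NOTES.md): w = m/φ(m); L = ∑_{p∈I} 1/p ≥ 9w²/η²; z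
= (log x)^{1/3}, D = z^s, e^{-s} ≤ η/(24Kw)
(K = fundamental-lemma constant); P₁ ≥ 310·w(L+1)·log x/(L²η²) and P₁ ≥ log x; P₀ =
P₁^{exp(L)(1+o(1))} ≤ (log x)^{c}, c = exp(9w²/η² + O(1));
block precision ε ≤ L²η²/(256·C·(L+1)²) with C from |(P,2P] ∩ ℙ| ≤ 2P/log P and the pair-average
bound avg_{p≠q} 𝔖_pq ≤ C w². Local factors
of (pmn+h, qmn+h), p ≠ q > max(m,h,z), gcd(m,h) = 1: β_r = (r/(r−1))² for r | m; r/(r−1) for r = p,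
q and for r ∤ m with r | h(p−q);
(1−2/r)(r/(r−1))² otherwise; 𝔖_pq > 0 always. Known one-sided results on the mirror problem
(fixed-modulus variance V(x;q)): lower bound
(1/2−o(1))x log q for x/(log x)^A ≤ q ≤ x unconditionally (Friedlander–Goldston 1996 Thm 2),
asymptotic only under RH + uniform prime pairs
with square-root error (their Thm 3; Fiorilli arXiv:1301.5663 p.3: "still an open problem … in any
range of q"). Items at open: 7
(2 cruxes, 4 support, 1 assembly).

DEFINITION REQUESTS. None. All objects exist: Literature.NumberTheory.Sieve.AffLinForm /
vonMangoldtSum / archFactor / singularProduct / realBox (Green–Tao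
2010 file), ArithmeticFunction.moebius / vonMangoldt (Mathlib),
Literature.NumberTheory.Sieve.MoebiusShiftedPrimesConjecture. Literature want
filed: acq-02496 (Hildebrand 1989, PLMS 59) for the grounder of KataiRigidity.

Novelty: Searches (2026-08-15): grep of all 7 Theses/*.lean of the sub for
Katai|Kátai|Bourgain|BSZ|Turán|Kubilius (0 hits); `ledger idea list --sub
GeneralizedHardyLittlewood` (105 cards; katai-necessity-shifted-primes retired as superseded by this
card; no other Kátai card);
`ledger negatives --problem Parity` (0); `lit frontier Parity --since 2021` (30 rows, none on μ at
shifted primes via multiplicativity);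
`lit bridges Parity --cross any` (30, generic); `lit galaxy search "Barban-Davenport-Halberstam
theorem" --star all` (17 rows: Brüdern–Wooley
sparse variance pdf:5809745032986154960 read pp.1–2, BFI, Fiorilli–de la Bretèche); `lit search
--source crossref` for Hooley BDH VIII–XIX
(doi:10.1515/crll.1998.059 = third moment per zbMATH), Friedlander–Goldston
(doi:10.1093/qmath/47.3.313, held, pp.1–4 READ: Thm 2 lower
bound, Thm 3 asymptotic under RH + uniform twin pairs), Fiorilli (arXiv:1301.5663 READ p.3); `lit
search --source zbmath` "Möbius function
shifted primes" (9: MurtyVatwani2017, Lichtman2020 with Hildebrand 1989 named as origin of the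
conjecture, Friedlander–Gong–Shparlinski),
"Hildebrand additive and multiplicative functions on shifted primes" (7:
doi:10.1112/plms/s3-59.2.209 'partial analogue of Halász on
shifted primes', Timofeev 1991/1994 surveys, Elliott 1992); searchd/OpenAlex/arXiv API unavailable
(rc 75 / 429) — hybrid full-text
search of held books NOT run; the card's audit (refuter-novelty-audit-8) had already checked
Lichtman QJM 2021, BSZ 2013, Tao 2016,
Sar  [refs: 10.1515/crll.1998.059, 10.1093/qmath/47.3.313, 10.1112/plms/s3-59.2.209, 1301.5663, 1110.0992, doi:10.1515/crll.1998.059, doi:10.1093/qmath/47.3.313, doi:10.1112/plms/s3-59.2.209, MurtyVatwani2017, Lichtman2020, BourgainSarnakZiegler2013]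

Barriers (technique_class: katai-bsz multiplicative-propagation shifted-primes): - technique_class: katai-bsz multiplicative-propagation shifted-primes
- Literature.Barriers.Parity.SelbergParityBarrier: not evaded and not claimed to be —
BlockPairExcess is itself parity-sensitive (the ghost 1+λ doubles every N_pq coherently and passes
KataiRigidity's consistency test); the route trades the atom's parity bit for a COHERENT family of
bits and proves they are not independent; KataiRigidity uses no sieve lower bound and no Type-I/II
decomposition of the target.
- Literature.Barriers.Parity.PrimePairParity: applies to BlockPairExcess exactly as to twins (no
weight-insertion-invariant deduction can give the (1+ε) upper bound, even on GEH); conceded — the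
bet is only that an averaged one-sided statement over a polylog family is a better-posed target than
a single pair, and that its refutation would be informative.
- Literature.Barriers.Parity.LogarithmicAveraging: evaded — everything is Cesàro (Turán–Kubilius +
Cauchy–Schwarz at a fixed x); no entropy decrement, no scale selection; the price is the polylog
window, paid explicitly.
- Literature.Barriers.Parity.FriedlanderGranvilleUniformityBarrier: the uniformity asked of the
family (coefficients and constant ≤ (log N)^c at length N) is Granville's safe regime N > height^ε,
not the refuted regime N ≍ (log height)^B; Maier-matrix irregularities do not reach it.
- Literature.Barriers.Parity.UniformBatemanHornBarrier: same remark (degree 1, height polylog in the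
length).
- Literature.Barriers.Parity.LargeSieveLevelH

Novelty grade: new-combination — REVIEW 2026-08-15 (route already CLOSED retired by operator, D-0027 §2.1; note filed for whoever re-files from card katai-propagation-shifted-primes). new-combination (concur w/ audit-8). TECHNICAL: (1) BlockPairExcess (stmt-7848) elaborates verbatim against Mathlib+LinearEquationsInPrimes (W2.lean  (refuter refuter-rreview-route-SmoothPoincare4-Sy-1eea1645-0, 2026-08-15T13:59:32Z; prior: arXiv:1110.0992 Thm 2 (BSZ finite Katai criterion), Katai 1986 Acta Math. Hungar. 47, arXiv:1509.05422 §2 (Tao entropy-decrement form), doi:10.1112/plms/s3-59.2.209 (Hildebrand 1989, TK/Halasz on shifted primes), doi:10.1093/qmath/47.3.313 (Friedlander-Goldston 1996, mirror variance problem))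

History (route lifecycle, newest last):
- 2026-08-15T13:49:50Z · CLOSED retired — not-a-thesis: assembly does not conclude the sub-problem Statement (operator:999:1257524)

sub-problem: GeneralizedHardyLittlewood · status: closed(retired) · opened planner-plancard-Parity-GeneralizedHardyLittl-4eebb776-0 2026-08-15T12:19:16Z · rev 0 · ledger route-Parity-KataiPropagation
GENERATED by the gate from the ledger (D-0016/17). Provers cite these decls: `theorem foo : Summit.Parity.GeneralizedHardyLittlewood.Theses.KataiPropagation.<Decl> := …` in Summits/Parity/GeneralizedHardyLittlewood/Theorems/<Name>.lean.
-/

namespace Summit.Parity.GeneralizedHardyLittlewood.Theses.KataiPropagation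

open scoped BigOperators Topology Manifold Classical MeasureTheory ProbabilityTheory Matrix InnerProductSpace ComplexConjugate ContinuousMap
open Filter Set Function TopologicalSpace MeasureTheory

attribute [summit_statement] _root_.GeneralizedHardyLittlewood

/-- item stmt-Parity-7848 · crux · rank 2 · closed · moot by None · by planner
why it might fail: A (1+ε)-sharp UPPER bound for prime pairs is parity-blocked per system (Bombieri's ghost 1+λ doubles every N_pq coherently; sieves stop at 2–4×HL) and the block averages only ≍P²/log²P = polylog² systems — no ternary structure; a Hooley-type variance bound open even on GRH.
sources: doi:10.1093/qmath/47.3.313, arXiv:1301.5663, GreenTao2010, GoldstonMontgomery1987, Harman2007, Literature.Barriers.Parity.PrimePairParity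
[crux] for all m, h ≥ 1, c > 0, ε > 0 there is x₀ such that for x ≥ x₀ and every natural P with log
x ≤ P ≤ (log x)^c: ∑ over ordered pairs of distinct primes p, q ∈ (P, 2P] of [∑_{1≤n≤x/max(p,q)}
Λ(pmn+h)Λ(qmn+h) − 𝔖(pm,qm,h)·x/max(p,q)] ≤ ε x P/(log P)², 𝔖 =
Literature.NumberTheory.Sieve.singularProduct of the Green–Tao system (pm·n+h, qm·n+h) (card item
r3, weakened to one-sided / block-averaged / o(1) precision). [difficulty: open-problem] -/
@[route_item "route-Parity-KataiPropagation"]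
def BlockPairExcess : Prop :=
  ∀ m h : ℕ, 1 ≤ m → 1 ≤ h → ∀ c : ℝ, 0 < c → ∀ ε : ℝ, 0 < ε → ∃ x₀ : ℕ, ∀ x : ℕ, x₀ ≤ x → ∀ P : ℕ, Real.log x ≤ P → (P : ℝ) ≤ Real.log x ^ c → (∑ p ∈ Finset.filter Nat.Prime (Finset.Ioc P (2 * P)), ∑ q ∈ Finset.filter Nat.Prime (Finset.Ioc P (2 * P)) with q ≠ p, ((∑ n ∈ Finset.Icc 1 (x / max p q), ArithmeticFunction.vonMangoldt (p * m * n + h) * ArithmeticFunction.vonMangoldt (q * m * n + h)) - Literature.NumberTheory.Sieve.singularProduct ![(⟨![((p * m : ℕ) : ℤ)], (h : ℤ)⟩ : Literature.NumberTheory.Sieve.AffLinForm 1), ⟨![((q * m : ℕ) : ℤ)], (h : ℤ)⟩] * ((x : ℝ) / max p q))) ≤ ε * x * P / Real.log P ^ 2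

/-- item stmt-Parity-7849 · crux · rank 3 · closed · moot by None · by planner
why it might fail: Budget checked by hand only: TK wants L≥9w²/η², the diagonal wants P₁≳w(L+1)log x/(L²η²), block precision ε≍(Lη/(L+1))² suffices since ∑_j w_j/j≈L cancels; a hidden log-loss in the model cross terms (FL at z=(log x)^{1/3}) or in ∑_j 1/j would force (log x)^{-A} precision instead.
sources: BourgainSarnakZiegler2013, Tao2012ChowlaSarnakBlog, TaoFMP2016, doi:10.1112/plms/s3-59.2.209, MontgomeryVaughan2007, Literature.NumberTheory.LFunctions.siegel_walfisz_holds
[crux] KÁTAI RIGIDITY (unconditional, one-sided; card item r2 sharpened): for all m, h ≥ 1 and η > 0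
there are c, ε > 0 and x₀ such that for every x ≥ x₀ with |∑_{d≤x} μ(d)Λ(dm+h)| ≥ ηx there is a
natural P, log x ≤ P ≤ (log x)^c, whose block (P,2P] has prime-pair EXCESS ∑_{p≠q} [N_pq(x) −
𝔖_pq·x/max(p,q)] ≥ ε x P/(log P)². Proof plan (NOTES.md): TK on the Λ(dm+h)-weighted support with I
= primes in (P₁,P₀], L = ∑1/p ≥ 9w²/η² (w = m/φ(m)); Kátai switch; model ν = wV⁻¹·1[(dm+h,
P_m(z))=1], z = (log x)^{1/3}, killed against μ by the β-sieve majorant + Siegel–Walfisz for μ;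
dyadic Cauchy–Schwarz with P₁ ≍ C(η,m) log x, P₀ = (log x)^{exp(9w²/η²+O(1))}; model cross terms =
𝔖_pq·y(1+O(e^{-s}+1/z+1/P₁)) by the fundamental lemma (κ = 1, 2) and Siegel–Walfisz for primes
(moduli ≤ polylog); all inputs proved in tree. [difficulty: XL] -/
@[route_item "route-Parity-KataiPropagation"]
def KataiRigidity : Prop :=
  ∀ m h : ℕ, 1 ≤ m → 1 ≤ h → ∀ η : ℝ, 0 < η → ∃ c : ℝ, 0 < c ∧ ∃ ε : ℝ, 0 < ε ∧ ∃ x₀ : ℕ, ∀ x : ℕ, x₀ ≤ x → η * x ≤ |∑ d ∈ Finset.Icc 1 x, (ArithmeticFunction.moebius d : ℝ) * ArithmeticFunction.vonMangoldt (d * m + h)| → ∃ P : ℕ, Real.log x ≤ P ∧ (P : ℝ) ≤ Real.log x ^ c ∧ ε * x * P / Real.log P ^ 2 ≤ ∑ p ∈ Finset.filter Nat.Prime (Finset.Ioc P (2 * P)), ∑ q ∈ Finset.filter Nat.Prime (Finset.Ioc P (2 * P)) with q ≠ p, ((∑ n ∈ Finset.Icc 1 (x / max p q), ArithmeticFunction.vonMangoldt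 (p * m * n + h) * ArithmeticFunction.vonMangoldt (q * m * n + h)) - Literature.NumberTheory.Sieve.singularProduct ![(⟨![((p * m : ℕ) : ℤ)], (h : ℤ)⟩ : Literature.NumberTheory.Sieve.AffLinForm 1), ⟨![((q * m : ℕ) : ℤ)], (h : ℤ)⟩] * ((x : ℝ) / max p q))

/-- item stmt-Parity-0612 · support · rank 9 · closed · moot by None · by planner
sources: Literature.NumberTheory.Sieve.MoebiusShiftedPrimesConjecture, Lichtman2020, MurtyVatwani2017
Atom (M_m,h): for all m ≥ 1, h ≥ 1: ∑_{d ≤ x} μ(d) Λ(dm + h) = o(x), i.e. the Möbius function of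
(p-h)/m does not correlate with primality of p along p ≡ h (mod m). Open (parity-breaking); m = 1 is
'μ(p - h) has mean 0 over primes'. -/
@[route_item "route-Parity-KataiPropagation"]
def MobiusDilatedShiftedPrimes : Prop :=
  ∀ m h : ℕ, 1 ≤ m → 1 ≤ h → (fun x : ℕ => ∑ d ∈ Finset.Icc 1 x, (ArithmeticFunction.moebius d : ℝ) * ArithmeticFunction.vonMangoldt (d * m + h)) =o[Filter.atTop] fun x : ℕ => (x : ℝ)

/-- item stmt-Parity-7850 · support · rank 9 · closed · moot by None · by planner
sources: GreenTao2010, Granville1995Irregularities, Literature.Barriers.Parity.UniformBatemanHornBarrier, Literature.Barriers.Parity.FriedlanderGranvilleUniformityBarrier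
[support] the GHL-shaped sufficient condition (stronger than BlockPairExcess, two-sided and uniform;
not on the assembly chain; filed so that GHL-family routes share it): Green–Tao Conjecture 1.2
verbatim — same vonMangoldtSum / archFactor / singularProduct, d = 1, t = 2, error ≤ εN, all convex
K ⊆ [−N,N] — for the systems (a·n + h, b·n + h), a ≠ b ≥ 1, h ≠ 0, with POLYLOG uniformity a, b, |h|
≤ (log N)^c replacing ‖Ψ‖_N ≤ L. Safe side of the Maier / Friedlander–Granville uniformity barrier
(length N ≥ height^{1/o(1)}, Granville's regime x > h(F)^ε). [difficulty: open-problem] -/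
@[route_item "route-Parity-KataiPropagation"]
def PolylogTwinFamilyHL : Prop :=
  ∀ c : ℝ, 0 < c → ∀ ε : ℝ, 0 < ε → ∃ N₀ : ℕ, ∀ N : ℕ, N₀ ≤ N → ∀ a b : ℕ, ∀ h : ℤ, 1 ≤ a → 1 ≤ b → a ≠ b → h ≠ 0 → (a : ℝ) ≤ Real.log N ^ c → (b : ℝ) ≤ Real.log N ^ c → |(h : ℝ)| ≤ Real.log N ^ c → ∀ K : Set (Fin 1 → ℝ), Convex ℝ K → K ⊆ Literature.NumberTheory.Sieve.realBox 1 N → |Literature.NumberTheory.Sieve.vonMangoldtSum ![(⟨![(a : ℤ)], h⟩ : Literature.NumberTheory.Sieve.AffLinForm 1), ⟨![(b : ℤ)], h⟩] K N - Literature.NumberTheory.Sieve.archFactor ![(⟨![(a : ℤ)], h⟩ : Literature.NumberTheory.Sieve.AffLinForm 1), ⟨![(b : ℤ)], h⟩] K * Literature.NumberTheory.Sieve.singularProduct ![(⟨![(a : ℤ)], h⟩ : Literature.NumberTheory.Sieve.AffLinForm 1), ⟨![(b : ℤ)], h⟩]| ≤ ε * N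

/-- item stmt-Parity-7851 · support · rank 9 · closed · moot by None · by planner
sources: GreenTao2010
[support] glue: PolylogTwinFamilyHL → BlockPairExcess. Apply the uniform statement with c+2, ε/8 to
each system (pm·n+h, qm·n+h) on K = [1, N], N = ⌊x/max(p,q)⌋ (archFactor = N − 1, vonMangoldtSum =
the pair sum exactly), sum over the ≤ 4P²/log²P ordered pairs of the block and absorb ∑𝔖_pq ≪_m P²
log log P/log²P = o(xP/log²P); needs convergence and the bound 𝔖_pq ≪ w²·|p−q|/φ(|p−q|) for the
explicit singular product (Green–Tao Lemma 1.3 for this family, elementary). [difficulty: M] -/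
@[route_item "route-Parity-KataiPropagation"]
def UniformToBlock : Prop :=
  PolylogTwinFamilyHL → BlockPairExcess

/-- item stmt-Parity-7852 · support · rank 9 · closed · moot by None · by planner
sources: Lichtman2020, BourgainSarnakZiegler2013, Literature.NumberTheory.Sieve.MoebiusShiftedPrimesConjecture
[support] the same mechanism for NEGATIVE constants: Kátai on the support {n : n − h prime} gives
systems (pk − h, qk − h); with PolylogTwinFamilyHL (h ∈ ℤ, both signs) and partial summation from
Λ-weights to the prime count one gets the registered folklore conjecture ∑_{p≤X} μ(p+h) = o(π(X))
for every h ≥ 1 (Lichtman 2020 p.1; Sarnak Problem 5.2 at h = 1). Provable now by re-running the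
KataiRigidity proof with −h. [difficulty: XL] -/
@[route_item "route-Parity-KataiPropagation"]
def FolkloreBridge : Prop :=
  PolylogTwinFamilyHL → Literature.NumberTheory.Sieve.MoebiusShiftedPrimesConjecture

/-- item stmt-Parity-7853 · assembly · rank 1 · closed · moot by None · by planner
sources: BourgainSarnakZiegler2013, MurtyVatwani2017
[assembly] KataiRigidity → BlockPairExcess → MobiusDilatedShiftedPrimes (= stmt-Parity-0612, the
terminal node shared with routes MobiusShiftedPrimes and ShiftedMultiplicationTable). -/
@[route_item "route-Parity-KataiPropagation"]
def Assembly : Prop :=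
  KataiRigidity → BlockPairExcess → MobiusDilatedShiftedPrimes

end Summit.Parity.GeneralizedHardyLittlewood.Theses.KataiPropagation
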